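import Mathlib.Analysis.Calculus.InverseFunctionTheorem.Deriv
import Mathlib.Analysis.Calculus.Deriv.Pow
import Mathlib.Analysis.Normed.Field.ProperSpace
import Mathlib.Algebra.Order.Archimedean.Basic
import Mathlib.GroupTheory.Index
import HarnessLib

/-!
# The square classes `Eˣ ∕ Eˣ²` of a locally compact complete non-discrete normed field with `2 ≠ 0` are FINITE
# (Neukirch, *Algebraic Number Theory*, Ch. II (5.8) Cor.: `(K^× : K^{×n})` finite for a `p`-adic field; Serre, *A Course in Arithmetic*, Ch. II §3.3)

Topic `NumberTheory/LocalFields`; namespace `Literature.NumberTheory.LocalFields`.  THEOREMS ONLY (no definition, no instance, no notation, no named fact,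
no `sorry`); Mathlib-only imports.  Cell `pub/hodgecm-mathlib`, crux H413 = `stmt-HodgeConjecture-24833` (supports-only lane), line LH6 «StCharTS», (S-𝔇) datum road,
brick (B1) of the p03 lineage's «CARTAN-FIN (N1)» road (finitely many conjugacy classes of Cartan subgroups of `U(H)(F_v)`: the count of `U(H)`-classes inside a
stable class of tori is bounded by `|(K[γ]^τ)ˣ ∕ N(K[γ]ˣ)| ≤ |(K[γ]^τ)ˣ ∕ squares|`, a product of square-class groups of finite extensions of `F_v`).

THE MATHEMATICS.  Let `E` be a nontrivially normed field which is complete and locally compact (e.g. a finite extension of `ℚ_p`, or `ℝ`, `ℂ`), with `(2 : E) ≠ 0`.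
(1) SQUARES ARE A NEIGHBOURHOOD OF `1`: `x ↦ x²` has strict derivative `2 ≠ 0` at `1`, so by the inverse function theorem over the complete field `E` (Mathlib
`HasStrictDerivAt.map_nhds_eq`) it maps `𝓝 1` onto `𝓝 1`; hence the set of squares is a neighbourhood of `1` (`range_sq_mem_nhds_one`).
(2) A COMPACT FUNDAMENTAL ANNULUS: with `π ∈ E`, `0 < ‖π‖ < 1`, every `x ≠ 0` is `x = a · c²` with `‖π‖² < ‖a‖ ≤ 1` (`exists_mem_annulus_mul_sq`: `c = π^{-(n+1)}` for the
`n ∈ ℤ` with `‖π‖^{-2n} < ‖x‖ ≤ ‖π‖^{-2(n+1)}`), and the annulus `A = {‖π‖² ≤ ‖a‖ ≤ 1}` is compact (`E` is proper, Mathlib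
`ProperSpace.of_nontriviallyNormedField_of_weaklyLocallyCompactSpace`) and misses `0`.
(3) For `a ∈ A` the set `{b : b·a⁻¹ is a square}` is a neighbourhood of `a`; finitely many of them cover `A` (`IsCompact.elim_nhds_subcover`), so finitely many `a_i`
represent every unit modulo squares: **`exists_finset_forall_eq_mul_sq`** (`∀ x : Eˣ, ∃ a ∈ T, ∃ c, x = a·c²`), whence **`finiteIndex_range_powMonoidHom_two`**
(`Eˣ² = range (powMonoidHom 2)` has finite index) and `finite_quotient_range_powMonoidHom_two`.
No valuation, residue field or Hensel lemma is used; the index itself (Neukirch II (5.8)) is NOT computed.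

## References
* [NeukirchANT1999] J. Neukirch, *Algebraic Number Theory*, Grundlehren 322 (1999), Ch. II (5.7)–(5.8) (finiteness of `K^×∕K^{×n}` for `p`-adic `K`).
* [Serre1973] J.-P. Serre, *A Course in Arithmetic*, GTM 7 (1973), Ch. II §3.3 (`ℚ_p^×∕ℚ_p^{×2}`).
* [PlatonovRapinchuk1994] V. Platonov, A. Rapinchuk, *Algebraic Groups and Number Theory* (1994), §6.4 (finiteness of conjugacy classes of maximal tori over local
  fields — the consumer).
-/

set_option autoImplicit false

open Filter Topology Set Metric

namespace Literature.NumberTheory.LocalFields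

section SquareNhds

variable {E : Type*} [NontriviallyNormedField E] [CompleteSpace E]

/-- **Squares form a neighbourhood of `1`** in a complete nontrivially normed field with `2 ≠ 0`: `x ↦ x²` has strict derivative `2 ≠ 0` at `1`,
so it maps `𝓝 1` onto `𝓝 1` (inverse function theorem). [cite: NeukirchANT1999, Ch. II (5.7)] -/
theorem range_sq_mem_nhds_one (h2 : (2 : E) ≠ 0) : Set.range (fun x : E => x ^ 2) ∈ 𝓝 (1 : E) := by
  have hd : HasStrictDerivAt (fun x : E => x ^ 2) (((2 : ℕ) : E) * (1 : E) ^ (2 - 1)) 1 := hasStrictDerivAt_pow 2 (1 : E)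
  have h2' : ((2 : ℕ) : E) * (1 : E) ^ (2 - 1) ≠ 0 := by
    rw [one_pow, mul_one, Nat.cast_ofNat]; exact h2
  have hmap := hd.map_nhds_eq h2'
  rw [one_pow] at hmap
  rw [← hmap]
  exact range_mem_map

/-- For `a ≠ 0` the set of `b` with `b · a⁻¹` a square is a neighbourhood of `a`. [cite: NeukirchANT1999, Ch. II (5.7)] -/
theorem setOf_div_isSq_mem_nhds (h2 : (2 : E) ≠ 0) {a : E} (ha : a ≠ 0) :
    {b : E | ∃ c : E, c ^ 2 = b * a⁻¹} ∈ 𝓝 a := by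
  have hcont : Tendsto (fun b : E => b * a⁻¹) (𝓝 a) (𝓝 1) := by
    have h : Tendsto (fun b : E => b * a⁻¹) (𝓝 a) (𝓝 (a * a⁻¹)) := tendsto_id.mul_const a⁻¹
    rwa [mul_inv_cancel₀ ha] at h
  have hpre := hcont (range_sq_mem_nhds_one h2)
  refine Filter.mem_of_superset hpre ?_
  rintro b ⟨c, hc⟩
  exact ⟨c, hc⟩

end SquareNhds

section Annulus

variable {E : Type*} [NontriviallyNormedField E]

/-- **Reduction to the annulus**: if `0 < ‖π‖ < 1`, every `x ≠ 0` is `a · c²` with `c ≠ 0` and `‖π‖² < ‖a‖ ≤ 1` (take `c = π^{-(n+1)}` for the `n ∈ ℤ` with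
`‖π‖^{-2n} < ‖x‖ ≤ ‖π‖^{-2(n+1)}`). [cite: NeukirchANT1999, Ch. II (5.7)] -/
theorem exists_mem_annulus_mul_sq {π : E} (hπ0 : 0 < ‖π‖) (hπ1 : ‖π‖ < 1) {x : E} (hx : x ≠ 0) :
    ∃ a c : E, c ≠ 0 ∧ ‖π‖ ^ 2 < ‖a‖ ∧ ‖a‖ ≤ 1 ∧ x = a * c ^ 2 := by
  have hπne : π ≠ 0 := norm_pos_iff.1 hπ0
  have hπ2 : 0 < ‖π‖ ^ 2 := pow_pos hπ0 2
  -- `b := ‖π‖⁻² > 1`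
  obtain ⟨b, hb⟩ : ∃ b : ℝ, b = (‖π‖ ^ 2)⁻¹ := ⟨_, rfl⟩
  have hb0 : 0 < b := by rw [hb]; exact inv_pos.2 hπ2
  have hb1 : 1 < b := by
    rw [hb, one_lt_inv_iff₀]; exact ⟨hπ2, by nlinarith⟩
  have hbinv : b⁻¹ = ‖π‖ ^ 2 := by rw [hb, inv_inv]
  obtain ⟨n, hn1, hn2⟩ := exists_mem_Ioc_zpow (norm_pos_iff.2 hx) hb1
  -- the norm of `π ^ (2(n+1))`
  have hnorm : ‖π ^ (2 * (n + 1))‖ = (b ^ (n + 1))⁻¹ := by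
    rw [norm_zpow, zpow_mul, ← inv_zpow, hbinv]
    norm_cast
  refine ⟨x * π ^ (2 * (n + 1)), π ^ (-(n + 1)), zpow_ne_zero _ hπne, ?_, ?_, ?_⟩
  · -- ‖π‖² < ‖x‖ / b^(n+1)  ⟸  b^n < ‖x‖
    rw [norm_mul, hnorm, ← div_eq_mul_inv, lt_div_iff₀ (zpow_pos hb0 _), ← hbinv, zpow_add_one₀ (ne_of_gt hb0),
      mul_comm (b ^ n) b, ← mul_assoc, inv_mul_cancel₀ (ne_of_gt hb0), one_mul]
    exact hn1
  · rw [norm_mul, hnorm, ← div_eq_mul_inv, div_le_one (zpow_pos hb0 _)]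
    exact hn2
  · rw [← zpow_natCast (π ^ (-(n + 1))) 2, ← zpow_mul, mul_assoc, ← zpow_add₀ hπne]
    have : 2 * (n + 1) + -(n + 1) * ((2 : ℕ) : ℤ) = 0 := by push_cast; ring
    rw [this, zpow_zero, mul_one]

/-- The annulus `{r ≤ ‖a‖ ≤ 1}` is compact in a locally compact nontrivially normed field (which is proper). [cite: NeukirchANT1999, Ch. II (5.7)] -/
theorem isCompact_normAnnulus_field [LocallyCompactSpace E] (r : ℝ) :
    IsCompact {a : E | r ≤ ‖a‖ ∧ ‖a‖ ≤ 1} := by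
  haveI : ProperSpace E := ProperSpace.of_nontriviallyNormedField_of_weaklyLocallyCompactSpace E
  have hsub : {a : E | r ≤ ‖a‖ ∧ ‖a‖ ≤ 1} = {a : E | r ≤ ‖a‖} ∩ closedBall (0 : E) 1 := by
    ext a; simp [mem_closedBall, dist_zero_right]
  rw [hsub]
  exact (isCompact_closedBall (0 : E) 1).inter_left (isClosed_le continuous_const continuous_norm)

end Annulus

section Main

variable {E : Type*} [NontriviallyNormedField E] [CompleteSpace E] [LocallyCompactSpace E]

/-- **Finitely many square classes (representatives)**: in a locally compact complete nontrivially normed field with `2 ≠ 0` there is a finite set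
`T ⊆ Eˣ` with `∀ x : Eˣ, ∃ a ∈ T, ∃ c : Eˣ, x = a · c²`. [cite: NeukirchANT1999, Ch. II (5.8) Cor.] -/
theorem exists_finset_forall_eq_mul_sq (h2 : (2 : E) ≠ 0) :
    ∃ T : Finset Eˣ, ∀ x : Eˣ, ∃ a ∈ T, ∃ c : Eˣ, x = a * c ^ 2 := by
  classical
  obtain ⟨π, hπ0, hπ1⟩ := NormedField.exists_norm_lt_one E
  have hAc : IsCompact {a : E | ‖π‖ ^ 2 ≤ ‖a‖ ∧ ‖a‖ ≤ 1} := isCompact_normAnnulus_field (‖π‖ ^ 2)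
  have hA0 : ∀ a ∈ {a : E | ‖π‖ ^ 2 ≤ ‖a‖ ∧ ‖a‖ ≤ 1}, a ≠ 0 := by
    intro a ha h0
    have h1 : ‖π‖ ^ 2 ≤ ‖a‖ := ha.1
    rw [h0, norm_zero] at h1
    exact absurd h1 (not_le.2 (pow_pos hπ0 2))
  -- neighbourhood cover of the compact annulus
  obtain ⟨t, htA, hcov⟩ := hAc.elim_nhds_subcover (fun a => {b : E | ∃ c : E, c ^ 2 = b * a⁻¹})
    (fun a ha => setOf_div_isSq_mem_nhds h2 (hA0 a ha))
  -- representatives: the (non-zero) elements of `t`, as units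
  refine ⟨t.attach.image (fun a : {y // y ∈ t} => Units.mk0 a.1 (hA0 a.1 (htA a.1 a.2))), fun x => ?_⟩
  obtain ⟨a, c, hc0, ha1, ha2, hx⟩ := exists_mem_annulus_mul_sq hπ0 hπ1 x.ne_zero
  have haA : a ∈ {a : E | ‖π‖ ^ 2 ≤ ‖a‖ ∧ ‖a‖ ≤ 1} := ⟨ha1.le, ha2⟩
  obtain ⟨a₀, ha₀t, hba₀⟩ : ∃ a₀ ∈ t, a ∈ {b : E | ∃ c : E, c ^ 2 = b * a₀⁻¹} := by
    have := hcov haA; simpa only [mem_iUnion, exists_prop] using this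
  obtain ⟨d, hd⟩ := hba₀
  have ha₀0 : a₀ ≠ 0 := hA0 a₀ (htA a₀ ha₀t)
  have hd0 : d ≠ 0 := by
    intro h; rw [h, zero_pow two_ne_zero] at hd
    exact (mul_ne_zero (hA0 a haA) (inv_ne_zero ha₀0)) hd.symm
  refine ⟨Units.mk0 a₀ ha₀0, Finset.mem_image.2 ⟨⟨a₀, ha₀t⟩, Finset.mem_attach _ _, rfl⟩, Units.mk0 (d * c) (mul_ne_zero hd0 hc0), Units.ext ?_⟩
  simp only [Units.val_mul, Units.val_pow_eq_pow_val, Units.val_mk0]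
  have ha : a = a₀ * d ^ 2 := by
    rw [hd]; field_simp
  rw [hx, ha]; ring

/-- **`Eˣ ∕ Eˣ²` is finite**: the subgroup of squares `range (powMonoidHom 2)` has finite index in `Eˣ`. [cite: NeukirchANT1999, Ch. II (5.8) Cor.] -/
theorem finiteIndex_range_powMonoidHom_two (h2 : (2 : E) ≠ 0) :
    ((powMonoidHom 2 : Eˣ →* Eˣ).range).FiniteIndex := by
  classical
  obtain ⟨T, hT⟩ := exists_finset_forall_eq_mul_sq (E := E) h2
  haveI : Finite (Eˣ ⧸ (powMonoidHom 2 : Eˣ →* Eˣ).range) := by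
    refine Finite.of_surjective (fun a : (T : Set Eˣ) => (QuotientGroup.mk (a : Eˣ) : Eˣ ⧸ (powMonoidHom 2 : Eˣ →* Eˣ).range)) ?_
    intro q
    induction q using QuotientGroup.induction_on with
    | H x =>
      obtain ⟨a, haT, c, hx⟩ := hT x
      refine ⟨⟨a, haT⟩, ?_⟩
      rw [QuotientGroup.eq]
      refine ⟨c, ?_⟩
      rw [powMonoidHom_apply, hx, ← mul_assoc, inv_mul_cancel, one_mul]
  exact Subgroup.finiteIndex_of_finite_quotient

/-- The quotient `Eˣ ∕ Eˣ²` is a finite type. [cite: NeukirchANT1999, Ch. II (5.8) Cor.] -/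
theorem finite_quotient_range_powMonoidHom_two (h2 : (2 : E) ≠ 0) :
    Finite (Eˣ ⧸ (powMonoidHom 2 : Eˣ →* Eˣ).range) := by
  haveI := finiteIndex_range_powMonoidHom_two (E := E) h2
  exact Subgroup.finite_quotient_of_finiteIndex

/-- Square classes in `E` itself: finitely many non-zero `a_i` such that every `x ≠ 0` is `a_i · c²` with `c ≠ 0`. [cite: NeukirchANT1999, Ch. II (5.8) Cor.] -/
theorem exists_finset_forall_ne_zero_eq_mul_sq (h2 : (2 : E) ≠ 0) :
    ∃ T : Finset E, (∀ a ∈ T, a ≠ 0) ∧ ∀ x : E, x ≠ 0 → ∃ a ∈ T, ∃ c : E, c ≠ 0 ∧ x = a * c ^ 2 := by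
  classical
  obtain ⟨T, hT⟩ := exists_finset_forall_eq_mul_sq (E := E) h2
  refine ⟨T.image (fun u : Eˣ => (u : E)), fun a ha => ?_, fun x hx => ?_⟩
  · obtain ⟨u, -, rfl⟩ := Finset.mem_image.1 ha; exact u.ne_zero
  · obtain ⟨a, haT, c, hxe⟩ := hT (Units.mk0 x hx)
    refine ⟨(a : E), Finset.mem_image.2 ⟨a, haT, rfl⟩, (c : E), c.ne_zero, ?_⟩
    have := congrArg Units.val hxe
    simpa only [Units.val_mk0, Units.val_mul, Units.val_pow_eq_pow_val] using this

end Main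

end Literature.NumberTheory.LocalFields
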